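import Summits.ValiantsHypothesis.ValiantsHypothesis.Theorems.DivisionGapPerDivisionHardStubBlockSubstFacePer
import Summits.ValiantsHypothesis.ValiantsHypothesis.Theorems.DivisionGapPerDivisionHardStubFaceDescent
import Literature.Computability.AlgebraicComplexity.NewtonPolygonTauTransfer

/-!
# Crux `DivisionGap.PerDivisionHard` (stmt-ValiantsHypothesis-5065), line
`pair-descent-jss-endpoint` — negative lemma `perMul_fibre_card_ge`: per-multiples have rich
fibres everywhere

Route C of the line asks for a large placed block face `G = placedBlock eR eC` and an admissible
weight `w` cutting out `G` such that the top-`w` fibre of the cofactor is SPARSE.  This file records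
the floor for PER-MULTIPLE cofactors `per_n · g` (`g ≠ 0`): at EVERY placement and EVERY cutting
weight the top fibre has at least `b!` monomials.

Proof.  Initial forms are multiplicative over `ℝ≥0` and `w` cuts out `G`, so
`top_w(per_n · g) = facePer G · top_w(g)` (`topComponent_mul`, `topComponent_perPoly_eq_facePer`),
and over `ℝ≥0` supports multiply exactly: `supp = supp (facePer G) + supp (top_w g)`
(`JerrumSnir.support_mul_eq`).  Since `top_w g ≠ 0` (`topComponent_ne_zero`) the sumset contains a
translate of `supp (facePer G)` (`Finset.card_le_card_add_right`), and
`#supp (facePer G) ≥ #supp (P (facePer G)) = #supp per_b = b!` for the phase projection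
`P = aeval (blockSubst eR eC)` (`stub_blockSubstFacePer`, `JerrumSnir.card_support_perPoly`), because
`P` substitutes a variable or `1` for every variable and such substitutions do not increase the
number of monomials (`card_support_aeval_le_of_isMvTerm`).
-/

noncomputable section

-- `Summit.ValiantsHypothesis.ValiantsHypothesis.…` is the tree's mandated single-conjunct layout
-- (Sub = Summit), so the duplicated namespace component is intended.
set_option linter.dupNamespace false

namespace Summit.ValiantsHypothesis.ValiantsHypothesis.Theorems.DivisionGapPerDivisionHard

open MvPolynomial Literature.Computability.AlgebraicComplexity
open Summit.ValiantsHypothesis.ValiantsHypothesis.Theorems.ZeroOneTransfer.Negative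
open scoped NNReal Pointwise

variable {b k m n : ℕ}

/-- Every value of the phase projection `blockSubst` is a term (`X _` or `1`). [folklore] -/
private theorem isMvTerm_blockSubst (eR eC : BlockV b k m ≃ Fin n) (e : Fin n × Fin n) :
    IsMvTerm (blockSubst eR eC e) := by
  unfold blockSubst
  rcases eR.symm e.1 with i | y
  · exact ⟨Finsupp.single (i, phaseIdx i (eC.symm e.2)) 1, 1, rfl⟩
  · exact isMvTerm_one

/-- The placed face permanent has at least `b!` monomials: its phase projection is `per_b`
(`stub_blockSubstFacePer`), which has `b!` monomials (`JerrumSnir.card_support_perPoly`), and the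
projection does not increase the number of monomials (`card_support_aeval_le_of_isMvTerm`).
[folklore] -/
theorem factorial_le_card_support_facePer (eR eC : BlockV b k m ≃ Fin n) :
    b.factorial ≤ (facePer (placedBlock eR eC)).support.card := by
  calc b.factorial = (perPoly (Fin b) ℝ≥0).support.card :=
        (Literature.Barriers.ValiantsHypothesis.JerrumSnir.card_support_perPoly ℝ≥0).symm
    _ = (aeval (blockSubst eR eC) (facePer (placedBlock eR eC))).support.card := by
        rw [stub_blockSubstFacePer]
    _ ≤ (facePer (placedBlock eR eC)).support.card :=
        card_support_aeval_le_of_isMvTerm (isMvTerm_blockSubst eR eC) _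

/-- **Per-multiples have rich fibres (negative floor of route C, line
`pair-descent-jss-endpoint`).**  For a placement `eR eC` of the block arsenal, a weight `w` cutting
out the placed face `G`, and `g ≠ 0`, the top-`w` fibre of `per_n · g` has at least `b!` monomials:
it is `facePer G · top_w(g)` (`topComponent_mul`, `topComponent_perPoly_eq_facePer`), whose support
is the sumset `supp (facePer G) + supp (top_w g)` (`JerrumSnir.support_mul_eq`) and so contains a
translate of `supp (facePer G)`, of size `≥ b!` (`factorial_le_card_support_facePer`). [folklore] -/
theorem perMul_fibre_card_ge :
    ∀ (b k m n : ℕ) (eR eC : BlockV b k m ≃ Fin n) (w : Fin n × Fin n → ℕ)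
      (g : MvPolynomial (Fin n × Fin n) ℝ≥0), CutsOut w (placedBlock eR eC) → g ≠ 0 →
      Nat.factorial b ≤ (topComponent w (perPoly (Fin n) ℝ≥0 * g)).support.card := by
  intro b k m n eR eC w g hcut hg
  classical
  rw [topComponent_mul, topComponent_perPoly_eq_facePer hcut,
    Literature.Barriers.ValiantsHypothesis.JerrumSnir.support_mul_eq]
  exact (factorial_le_card_support_facePer eR eC).trans
    (Finset.card_le_card_add_right (support_nonempty.mpr (topComponent_ne_zero w hg)))

end Summit.ValiantsHypothesis.ValiantsHypothesis.Theorems.DivisionGapPerDivisionHard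

end
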